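import Summits.ValiantsHypothesis.ValiantsHypothesis.Theorems.BarrierLeverPartitionMinorsChowPeel
import Summits.ValiantsHypothesis.ValiantsHypothesis.Theorems.BarrierLeverPartitionMinorsChowHeightThree

/-!
# Route BarrierLever — Chow witnesses for partition minors (item 20172, CPM): BOUNDED-SIZE minors at
# EVERY height from a finite height slice

Helper file (`--supports stmt-ValiantsHypothesis-20172`; cell valiant-natproofs, rung V4, 𝒟-side of
door (c); seat val-np-p4 gen 11).  Closes NO item.  Conventions of items 19717 / 20172 / 20195: a
layout `(u, w)` of height `h` (`u w : Fin r → Finset (Fin h)`) is HIT when some product of `h + h`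
affine forms has nonsingular partition minor `det[coeff_{E (u i) (w j)} ∏ ℓ]`.

* `succ_le_of_unpeelable` — **support bound**: if `r` distinct subsets of `Fin m`, `m > 0`, cannot
  be peeled at any coordinate (for every `a` two of them differ exactly in `a`), then `m + 1 ≤ r`.
  Proof over `𝔽₂`: the difference of two indicator vectors differing exactly in `a` is the basis
  vector `e_a`, so the `≤ r - 1` differences `v_k - v_{i₀}` span `𝔽₂^m`.
* `chowHits_of_size_le` — **CPM at heights `≤ H` implies CPM for all layouts of SIZE `r ≤ H + 1` at
  EVERY height**: above height `H` a layout of size `≤ H + 1` is peelable on the row side or on the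
  column side... indeed on both (each unpeelable side forces `height + 1 ≤ r`), and the rank-one peel
  `chow_peel` (`…ChowPeel`) lowers the height keeping the size.
* `chowHits_of_size_le_three` — with the height slice `h ≤ 2` (`chowHits_of_height_le_two`):
  every injective layout pair with `r ≤ 3` is hit at every height;
* `chowHits_of_size_le_four` — with the height slice `h ≤ 3` (`chowHits_of_height_le_three`, the
  `224` certified locked layouts): **every injective layout pair with `r ≤ 4` is hit at EVERY height
  `h`** — item 20172's conclusion on ALL partition minors of size `≤ 4`, in the item's own regime of
  all large `h` (the item asks for every size `r ≤ 2^h`).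

WHAT THIS IS NOT: bounded-size slices only; item 20172 asks for minors of every size `r ≤ 2^h`;
nothing on items 20195 / 19717, on crux stmt-ValiantsHypothesis-14610, or on `VP` versus `VNP`.
-/

set_option linter.dupNamespace false

namespace Summit.ValiantsHypothesis.ValiantsHypothesis.Theorems.BarrierLever.ChowFactor

open Finset MvPolynomial

noncomputable section

/-! ## 1. The support bound for unpeelable families -/

/-- Two distinct sets with the same `a`-erasure differ exactly in `a`: membership agrees off `a`
and disagrees at `a`. -/
theorem mem_iff_of_erase_eq {m : ℕ} {S T : Finset (Fin m)} {a : Fin m} (he : S.erase a = T.erase a)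
    (hne : S ≠ T) : (∀ b, b ≠ a → (b ∈ S ↔ b ∈ T)) ∧ ¬ (a ∈ S ↔ a ∈ T) := by
  have hoff : ∀ b, b ≠ a → (b ∈ S ↔ b ∈ T) := fun b hb => by
    have h1 : b ∈ S.erase a ↔ b ∈ T.erase a := by rw [he]
    simpa [Finset.mem_erase, hb] using h1
  refine ⟨hoff, fun hiff => hne ?_⟩
  ext b
  by_cases hb : b = a
  · subst hb
    exact hiff
  · exact hoff b hb

/-- **Support bound.**  If `r` subsets of `Fin m` (`m > 0`) are pairwise distinct as listed by `u`
and for every coordinate `a` two of them have the same `a`-erasure (the family cannot be peeled at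
`a`), then `m + 1 ≤ r`: over `𝔽₂` the differences of indicator vectors span the whole space. -/
theorem succ_le_of_unpeelable {m r : ℕ} (u : Fin r → Finset (Fin m)) (hm : 0 < m)
    (hup : ∀ a : Fin m, ∃ i i' : Fin r, (u i).erase a = (u i').erase a ∧ u i ≠ u i') :
    m + 1 ≤ r := by
  classical
  obtain ⟨i₀, -, -⟩ := hup ⟨0, hm⟩
  -- indicator vectors over 𝔽₂ and the differences to `v i₀`
  let v : Fin r → (Fin m → ZMod 2) := fun i b => if b ∈ u i then 1 else 0
  let S : Finset (Fin m → ZMod 2) := (Finset.univ.erase i₀).image fun k => v k - v i₀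
  have hScard : S.card ≤ r - 1 := by
    refine Finset.card_image_le.trans ?_
    rw [Finset.card_erase_of_mem (Finset.mem_univ _), Finset.card_univ, Fintype.card_fin]
  have hmem : ∀ k : Fin r, v k - v i₀ ∈ Submodule.span (ZMod 2) (S : Set (Fin m → ZMod 2)) := by
    intro k
    by_cases hk : k = i₀
    · rw [hk, sub_self]
      exact Submodule.zero_mem _
    · refine Submodule.subset_span ?_
      rw [Finset.mem_coe]
      exact Finset.mem_image.mpr ⟨k, Finset.mem_erase.mpr ⟨hk, Finset.mem_univ k⟩, rfl⟩
  -- every basis vector is a difference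
  have hbasis : ∀ a : Fin m,
      (Pi.single a (1 : ZMod 2) : Fin m → ZMod 2) ∈ Submodule.span (ZMod 2) (S : Set (Fin m → ZMod 2)) := by
    intro a
    obtain ⟨i, i', he, hne⟩ := hup a
    obtain ⟨hoff, hat⟩ := mem_iff_of_erase_eq he hne
    have hdiff : v i - v i' = Pi.single a 1 := by
      funext b
      by_cases hb : b = a
      · subst hb
        rw [Pi.sub_apply, Pi.single_eq_same]
        by_cases h1 : b ∈ u i
        · have h2 : b ∉ u i' := fun h2 => hat ⟨fun _ => h2, fun _ => h1⟩
          simp [v, h1, h2]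
        · have h2 : b ∈ u i' := by
            by_contra h2
            exact hat ⟨fun h => absurd h h1, fun h => absurd h h2⟩
          simp [v, h1, h2]
      · rw [Pi.sub_apply, Pi.single_eq_of_ne hb]
        by_cases h1 : b ∈ u i
        · have h2 : b ∈ u i' := (hoff b hb).mp h1
          simp [v, h1, h2]
        · have h2 : b ∉ u i' := fun h2 => h1 ((hoff b hb).mpr h2)
          simp [v, h1, h2]
    rw [← hdiff, show v i - v i' = (v i - v i₀) - (v i' - v i₀) by abel]
    exact Submodule.sub_mem _ (hmem i) (hmem i')
  -- hence the span is everything and `m ≤ #S ≤ r - 1`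
  have htop : (⊤ : Submodule (ZMod 2) (Fin m → ZMod 2)) ≤
      Submodule.span (ZMod 2) (S : Set (Fin m → ZMod 2)) := by
    rw [← (Pi.basisFun (ZMod 2) (Fin m)).span_eq, Submodule.span_le]
    rintro x ⟨a, rfl⟩
    rw [Pi.basisFun_apply]
    exact hbasis a
  have hfin : m ≤ S.card := by
    have h1 := finrank_span_finset_le_card (R := ZMod 2) S
    have h2 : Module.finrank (ZMod 2) (⊤ : Submodule (ZMod 2) (Fin m → ZMod 2)) ≤
        Module.finrank (ZMod 2) (Submodule.span (ZMod 2) (S : Set (Fin m → ZMod 2))) :=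
      Submodule.finrank_mono htop
    rw [finrank_top, Module.finrank_fin_fun] at h2
    exact h2.trans h1
  have hr : 2 ≤ r := by
    obtain ⟨i, i', -, hne⟩ := hup ⟨0, hm⟩
    have hii : i ≠ i' := fun e => hne (by rw [e])
    have := Fintype.card_le_of_injective (fun b : Bool => if b then i else i')
      (fun b b' hbb => by cases b <;> cases b' <;> simp_all)
    simpa using this
  omega

/-- A layout that cannot be peeled at `a` (the `a`-erasure is not injective) has two rows with the
same `a`-erasure. -/
theorem exists_erase_eq_of_not_injective {m r : ℕ} (u : Fin r → Finset (Fin m))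
    (hu : Function.Injective u) (a : Fin m) (hna : ¬ Function.Injective fun i => (u i).erase a) :
    ∃ i i' : Fin r, (u i).erase a = (u i').erase a ∧ u i ≠ u i' := by
  obtain ⟨i, i', he, hne⟩ := Function.not_injective_iff.mp hna
  exact ⟨i, i', he, fun e => hne (hu e)⟩

/-! ## 2. Bounded size at every height -/

/-- Peeling keeps injectivity: if the `a`-erasure of an injective layout is injective, so is the
peeled (pulled-back) layout. -/
theorem preimage_succAbove_injective_of_erase {h r : ℕ} (a : Fin (h + 1))
    (u : Fin r → Finset (Fin (h + 1))) (hua : Function.Injective fun i => (u i).erase a) :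
    Function.Injective fun i => (u i).preimage a.succAbove Fin.succAbove_right_injective.injOn := by
  intro i i' hii
  apply hua
  show (u i).erase a = (u i').erase a
  rw [erase_eq_map_preimage_succAbove, erase_eq_map_preimage_succAbove]
  exact congrArg (Finset.map (Fin.succAboveEmb a)) hii

/-- **CPM at heights `≤ H` gives CPM for every layout of size `r ≤ H + 1` at EVERY height.** -/
theorem chowHits_of_size_le (H : ℕ)
    (slice : ∀ h : ℕ, h ≤ H → ∀ (r : ℕ) (u w : Fin r → Finset (Fin h)), Function.Injective u →
      Function.Injective w →
      ∃ ℓ : Fin (h + h) → MvPolynomial (Fin (h + h)) ℂ, (∀ q, (ℓ q).totalDegree ≤ 1) ∧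
        (Matrix.of fun i j : Fin r => coeff
          (∑ b ∈ u i, Finsupp.single (Fin.castAdd h b) 1 + ∑ d ∈ w j, Finsupp.single (Fin.natAdd h d) 1)
          (∏ q, ℓ q)).det ≠ 0)
    (h r : ℕ) (hr : r ≤ H + 1) (u w : Fin r → Finset (Fin h)) (hu : Function.Injective u)
    (hw : Function.Injective w) :
    ∃ ℓ : Fin (h + h) → MvPolynomial (Fin (h + h)) ℂ, (∀ q, (ℓ q).totalDegree ≤ 1) ∧
      (Matrix.of fun i j : Fin r => coeff
        (∑ b ∈ u i, Finsupp.single (Fin.castAdd h b) 1 + ∑ d ∈ w j, Finsupp.single (Fin.natAdd h d) 1)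
        (∏ q, ℓ q)).det ≠ 0 := by
  classical
  induction h with
  | zero => exact slice 0 (Nat.zero_le _) r u w hu hw
  | succ n ih =>
    by_cases hle : n + 1 ≤ H
    · exact slice (n + 1) hle r u w hu hw
    by_cases hpeel : ∃ a c : Fin (n + 1), Function.Injective (fun i => (u i).erase a) ∧
        Function.Injective (fun j => (w j).erase c)
    · obtain ⟨a, c, hua, hwc⟩ := hpeel
      exact chow_peel a c u w (ih _ _ (preimage_succAbove_injective_of_erase a u hua)
        (preimage_succAbove_injective_of_erase c w hwc))
    · exfalso
      push Not at hpeel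
      by_cases hrow : ∀ a : Fin (n + 1), ¬ Function.Injective (fun i => (u i).erase a)
      · have := succ_le_of_unpeelable u (Nat.succ_pos n)
          (fun a => exists_erase_eq_of_not_injective u hu a (hrow a))
        omega
      · push Not at hrow
        obtain ⟨a, ha⟩ := hrow
        have := succ_le_of_unpeelable w (Nat.succ_pos n)
          (fun c => exists_erase_eq_of_not_injective w hw c (hpeel a c ha))
        omega

/-- **Item 20172's conclusion for every injective layout pair of SIZE `r ≤ 3`, at every height `h`**
(from the height slice `h ≤ 2` of `…ChowHeightTwo`). -/
theorem chowHits_of_size_le_three (h r : ℕ) (hr : r ≤ 3) (u w : Fin r → Finset (Fin h))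
    (hu : Function.Injective u) (hw : Function.Injective w) :
    ∃ ℓ : Fin (h + h) → MvPolynomial (Fin (h + h)) ℂ, (∀ q, (ℓ q).totalDegree ≤ 1) ∧
      (Matrix.of fun i j : Fin r => coeff
        (∑ b ∈ u i, Finsupp.single (Fin.castAdd h b) 1 + ∑ d ∈ w j, Finsupp.single (Fin.natAdd h d) 1)
        (∏ q, ℓ q)).det ≠ 0 :=
  chowHits_of_size_le 2 (fun h hh r u w hu hw => chowHits_of_height_le_two h r hh u w hu hw)
    h r hr u w hu hw

/-- **Item 20172's conclusion for every injective layout pair of SIZE `r ≤ 4`, at every height `h`**: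
all partition minors of size at most `4` of products of `h + h` affine forms can be made nonzero, for
every `h` (from the height slice `h ≤ 3`, i.e. the `224` certified locked layouts of height `3`). -/
theorem chowHits_of_size_le_four (h r : ℕ) (hr : r ≤ 4) (u w : Fin r → Finset (Fin h))
    (hu : Function.Injective u) (hw : Function.Injective w) :
    ∃ ℓ : Fin (h + h) → MvPolynomial (Fin (h + h)) ℂ, (∀ q, (ℓ q).totalDegree ≤ 1) ∧
      (Matrix.of fun i j : Fin r => coeff
        (∑ b ∈ u i, Finsupp.single (Fin.castAdd h b) 1 + ∑ d ∈ w j, Finsupp.single (Fin.natAdd h d) 1)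
        (∏ q, ℓ q)).det ≠ 0 :=
  chowHits_of_size_le 3 (fun h hh r u w hu hw => chowHits_of_height_le_three h r hh u w hu hw)
    h r hr u w hu hw

end

end Summit.ValiantsHypothesis.ValiantsHypothesis.Theorems.BarrierLever.ChowFactor
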